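import Literature.NumberTheory.LFunctions.WeilMellinInversion
import Mathlib.Analysis.Calculus.BumpFunction.InnerProduct
import Mathlib.MeasureTheory.Integral.DominatedConvergence
import HarnessLib

/-!
# The cut-off package for the Weil transform

Stub `stub_cutoffMellin` of the line "Sketch (heat cone)" for the crux
`Summit.RiemannHypothesis.RiemannHypothesis.Theses.RuelleBand.ExactFirstBand`.  For a smooth
`g : ℝ → ℂ` with `∫ (‖g‖ + ‖g'‖ + ‖g''‖) e^{|t|/2} < ∞` and a smooth bump `χ` (`χ = 1` near `0`,
`0 ≤ χ ≤ 1`, compact support) the cut-offs `g_R(t) = χ(t/R) g(t)` satisfy: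

* `g_R` is a Weil test function for every `R > 0` (smooth with compact support,
  `Literature.NumberTheory.LFunctions.IsWeilTest`);
* UNIFORM strip decay `‖ĝ_R(s)‖ ≤ D/(1 + (Im s)²)` for `R ≥ 1` and `|Re s - 1/2| ≤ 1/2`: the tree's
  two-integrations-by-parts bound `Literature.NumberTheory.LFunctions.norm_weilMellin_le_of_abs_re_le`
  gives `weilDecayW (1/2) g_R / (1 + (Im s)²)`, and `(χ_R g)'' = χ_R'' g + 2 χ_R' g' + χ_R g''` with
  `|χ^{(j)}(t/R)|/R^j ≤ sup |χ^{(j)}|` (`R ≥ 1`) bounds `weilDecayW (1/2) g_R` by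
  `D = ∫ ‖g‖ e + ∫ (M₂ ‖g‖ + 2 M₁ ‖g'‖ + ‖g''‖) e`, `e = e^{|t|/2}`;
* pointwise convergence `ĝ_R(s) → ĝ(s)` (`R → ∞`) on the same closed strip, by dominated
  convergence with the dominator `‖g(t)‖ e^{|t|/2}` and `χ(t/R) → χ(0) = 1`.
-/

set_option linter.dupNamespace false

noncomputable section

open Complex MeasureTheory Filter Set
open scoped Topology ContDiff

namespace Summit.RiemannHypothesis.RiemannHypothesis.Theorems.RuelleBandExactFirstBand

open Literature.NumberTheory.LFunctions

/-! ## The rescaled cut-off `t ↦ χ (t / R)` and its derivatives -/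

/-- Chain rule for a rescaling: `d/dt f(t/R) = f'(t/R)/R`. -/
theorem stub_cutoffMellin_hasDerivAt_rescale {f : ℝ → ℝ} (hf : Differentiable ℝ f) (R t : ℝ) :
    HasDerivAt (fun t : ℝ => f (t / R)) (deriv f (t / R) / R) t := by
  have h : HasDerivAt (fun t : ℝ => f (t / R)) (deriv f (t / R) * (1 / R)) t :=
    (hf (t / R)).hasDerivAt.comp t ((hasDerivAt_id' t).div_const R)
  exact h.congr_deriv (mul_one_div _ _)

/-- A smooth bump is differentiable. -/
theorem stub_cutoffMellin_differentiable (χ : ContDiffBump (0 : ℝ)) : Differentiable ℝ χ :=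
  (χ.contDiff (n := ⊤)).differentiable (by simp)

/-- The derivative of a smooth bump is smooth. -/
theorem stub_cutoffMellin_contDiff_deriv (χ : ContDiffBump (0 : ℝ)) : ContDiff ℝ ∞ (deriv χ) :=
  (χ.contDiff (n := ⊤)).deriv'

/-- The derivative of a smooth bump is differentiable. -/
theorem stub_cutoffMellin_differentiable_deriv (χ : ContDiffBump (0 : ℝ)) :
    Differentiable ℝ (deriv χ) :=
  (stub_cutoffMellin_contDiff_deriv χ).differentiable (by simp)

/-- `d/dt (χ(t/R) : ℂ) = (χ'(t/R)/R : ℂ)`. -/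
theorem stub_cutoffMellin_hasDerivAt_cutoff (χ : ContDiffBump (0 : ℝ)) (R t : ℝ) :
    HasDerivAt (fun t : ℝ => ((χ (t / R) : ℝ) : ℂ)) ((deriv χ (t / R) / R : ℝ) : ℂ) t :=
  (stub_cutoffMellin_hasDerivAt_rescale (stub_cutoffMellin_differentiable χ) R t).ofReal_comp

/-- `d/dt (χ'(t/R)/R : ℂ) = (χ''(t/R)/R² : ℂ)`. -/
theorem stub_cutoffMellin_hasDerivAt_derivCutoff (χ : ContDiffBump (0 : ℝ)) (R t : ℝ) :
    HasDerivAt (fun t : ℝ => ((deriv χ (t / R) / R : ℝ) : ℂ))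
      ((deriv (deriv χ) (t / R) / R ^ 2 : ℝ) : ℂ) t := by
  have h := ((stub_cutoffMellin_hasDerivAt_rescale (stub_cutoffMellin_differentiable_deriv χ)
    R t).div_const R).ofReal_comp
  refine h.congr_deriv ?_
  push_cast
  ring

/-- The second derivative of a cut-off: `(χ_R g)'' = χ_R'' g + 2 χ_R' g' + χ_R g''`, where
`χ_R(t) = χ(t/R)`, `χ_R'(t) = χ'(t/R)/R`, `χ_R''(t) = χ''(t/R)/R²`. -/
theorem stub_cutoffMellin_deriv_deriv (χ : ContDiffBump (0 : ℝ)) {g : ℝ → ℂ}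
    (hg : ContDiff ℝ ∞ g) (R : ℝ) :
    deriv (deriv (fun t : ℝ => (χ (t / R) : ℂ) * g t)) = fun t =>
      ((deriv (deriv χ) (t / R) / R ^ 2 : ℝ) : ℂ) * g t
        + 2 * ((deriv χ (t / R) / R : ℝ) : ℂ) * deriv g t
        + (χ (t / R) : ℂ) * deriv (deriv g) t := by
  have hg1 : ∀ t, HasDerivAt g (deriv g t) t := fun t =>
    (hg.differentiable (by simp) t).hasDerivAt
  have hg' : ContDiff ℝ ∞ (deriv g) := hg.deriv'
  have hg2 : ∀ t, HasDerivAt (deriv g) (deriv (deriv g) t) t := fun t =>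
    (hg'.differentiable (by simp) t).hasDerivAt
  have h1 : deriv (fun t : ℝ => (χ (t / R) : ℂ) * g t) =
      fun t => ((deriv χ (t / R) / R : ℝ) : ℂ) * g t + (χ (t / R) : ℂ) * deriv g t :=
    funext fun t => ((stub_cutoffMellin_hasDerivAt_cutoff χ R t).fun_mul (hg1 t)).deriv
  rw [h1]
  funext t
  rw [(((stub_cutoffMellin_hasDerivAt_derivCutoff χ R t).fun_mul (hg1 t)).fun_add
    ((stub_cutoffMellin_hasDerivAt_cutoff χ R t).fun_mul (hg2 t))).deriv]
  ring

/-! ## The cut-offs are test functions -/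

/-- The complexified cut-off factor `t ↦ (χ(t/R) : ℂ)` is smooth. -/
theorem stub_cutoffMellin_contDiff_cutoff (χ : ContDiffBump (0 : ℝ)) (R : ℝ) :
    ContDiff ℝ ∞ (fun t : ℝ => ((χ (t / R) : ℝ) : ℂ)) :=
  Complex.ofRealCLM.contDiff.comp ((χ.contDiff (n := ⊤)).comp (contDiff_id.div_const R))

/-- For `R > 0` the cut-off factor vanishes where `R · rOut ≤ |t|`. -/
theorem stub_cutoffMellin_cutoff_eq_zero (χ : ContDiffBump (0 : ℝ)) {R : ℝ} (hR : 0 < R) {t : ℝ}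
    (ht : R * χ.rOut ≤ |t|) : χ (t / R) = 0 := by
  apply χ.zero_of_le_dist
  rw [Real.dist_eq, sub_zero, abs_div, abs_of_pos hR, le_div_iff₀ hR, mul_comm]
  exact ht

/-- For `R > 0` the cut-off `g_R = χ(·/R) g` has compact support. -/
theorem stub_cutoffMellin_hasCompactSupport (χ : ContDiffBump (0 : ℝ)) (g : ℝ → ℂ) {R : ℝ}
    (hR : 0 < R) : HasCompactSupport (fun t : ℝ => (χ (t / R) : ℂ) * g t) := by
  refine HasCompactSupport.intro (isCompact_closedBall (0 : ℝ) (R * χ.rOut)) fun t ht => ?_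
  rw [Metric.mem_closedBall, Real.dist_eq, sub_zero, not_le] at ht
  rw [stub_cutoffMellin_cutoff_eq_zero χ hR ht.le, Complex.ofReal_zero, zero_mul]

/-- **(i)** For `R > 0` the cut-off `g_R = χ(·/R) g` of a smooth `g` is a Weil test function. -/
theorem stub_cutoffMellin_isWeilTest (χ : ContDiffBump (0 : ℝ)) {g : ℝ → ℂ} (hg : ContDiff ℝ ∞ g)
    {R : ℝ} (hR : 0 < R) : IsWeilTest (fun t : ℝ => (χ (t / R) : ℂ) * g t) :=
  ⟨(stub_cutoffMellin_contDiff_cutoff χ R).mul hg, stub_cutoffMellin_hasCompactSupport χ g hR⟩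

/-! ## Uniform strip decay -/

/-- The derivatives `χ'`, `χ''` of a smooth bump are bounded (continuous with compact support). -/
theorem stub_cutoffMellin_exists_bounds (χ : ContDiffBump (0 : ℝ)) :
    ∃ M₁ M₂ : ℝ, (∀ x, ‖deriv χ x‖ ≤ M₁) ∧ (∀ x, ‖deriv (deriv χ) x‖ ≤ M₂) := by
  have h1 := stub_cutoffMellin_contDiff_deriv χ
  have h2 : ContDiff ℝ ∞ (deriv (deriv χ)) := h1.deriv'
  obtain ⟨M₁, hM₁⟩ := h1.continuous.bounded_above_of_compact_support χ.hasCompactSupport.deriv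
  obtain ⟨M₂, hM₂⟩ :=
    h2.continuous.bounded_above_of_compact_support χ.hasCompactSupport.deriv.deriv
  exact ⟨M₁, M₂, hM₁, hM₂⟩

/-- Triangle inequality for the three terms of `(χ_R g)''`. -/
theorem stub_cutoffMellin_norm_combo_le {a₀ a₁ a₂ x₀ x₁ x₂ : ℂ} {M₁ M₂ : ℝ}
    (h₂ : ‖a₂‖ ≤ M₂) (h₁ : ‖a₁‖ ≤ M₁) (h₀ : ‖a₀‖ ≤ 1) :
    ‖a₂ * x₀ + 2 * a₁ * x₁ + a₀ * x₂‖ ≤ M₂ * ‖x₀‖ + 2 * M₁ * ‖x₁‖ + ‖x₂‖ := by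
  refine norm_add₃_le.trans ?_
  rw [norm_mul, norm_mul, norm_mul, norm_mul, Complex.norm_two]
  nlinarith [mul_le_mul_of_nonneg_right h₂ (norm_nonneg x₀),
    mul_le_mul_of_nonneg_right h₁ (norm_nonneg x₁), mul_le_mul_of_nonneg_right h₀ (norm_nonneg x₂)]

/-- Pointwise bound on the second derivative of a cut-off, uniform in `R ≥ 1`:
`‖(χ_R g)''(t)‖ ≤ M₂ ‖g(t)‖ + 2 M₁ ‖g'(t)‖ + ‖g''(t)‖` (`M_j = sup ‖χ^{(j)}‖`, `0 ≤ χ ≤ 1`). -/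
theorem stub_cutoffMellin_norm_deriv_deriv_le (χ : ContDiffBump (0 : ℝ)) {g : ℝ → ℂ}
    (hg : ContDiff ℝ ∞ g) {M₁ M₂ : ℝ} (hM₁ : ∀ x, ‖deriv χ x‖ ≤ M₁)
    (hM₂ : ∀ x, ‖deriv (deriv χ) x‖ ≤ M₂) {R : ℝ} (hR : 1 ≤ R) (t : ℝ) :
    ‖deriv (deriv (fun t : ℝ => (χ (t / R) : ℂ) * g t)) t‖ ≤
      M₂ * ‖g t‖ + 2 * M₁ * ‖deriv g t‖ + ‖deriv (deriv g) t‖ := by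
  rw [stub_cutoffMellin_deriv_deriv χ hg R]
  have hR0 : 0 < R := one_pos.trans_le hR
  refine stub_cutoffMellin_norm_combo_le ?_ ?_ ?_
  · rw [Complex.norm_real, norm_div, Real.norm_eq_abs (R ^ 2), abs_of_pos (pow_pos hR0 2)]
    exact (div_le_self (norm_nonneg _) (one_le_pow₀ hR)).trans (hM₂ _)
  · rw [Complex.norm_real, norm_div, Real.norm_eq_abs R, abs_of_pos hR0]
    exact (div_le_self (norm_nonneg _) hR).trans (hM₁ _)
  · rw [Complex.norm_real, Real.norm_eq_abs, abs_of_nonneg χ.nonneg]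
    exact χ.le_one

/-- `∫ ‖g_R‖ e^{|t|/2} ≤ ∫ ‖g‖ e^{|t|/2}` (`0 ≤ χ ≤ 1`). -/
theorem stub_cutoffMellin_l1_le (χ : ContDiffBump (0 : ℝ)) {g : ℝ → ℂ}
    (h0 : Integrable (fun t : ℝ => ‖g t‖ * Real.exp (|t| / 2))) (R : ℝ) :
    ∫ t : ℝ, ‖(χ (t / R) : ℂ) * g t‖ * Real.exp (|t| / 2) ≤
      ∫ t : ℝ, ‖g t‖ * Real.exp (|t| / 2) := by
  refine integral_mono_of_nonneg
    (Eventually.of_forall fun t => mul_nonneg (norm_nonneg _) (Real.exp_pos _).le) h0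
    (Eventually.of_forall fun t => mul_le_mul_of_nonneg_right ?_ (Real.exp_pos _).le)
  rw [norm_mul, Complex.norm_real, Real.norm_eq_abs, abs_of_nonneg χ.nonneg]
  exact mul_le_of_le_one_left (norm_nonneg _) χ.le_one

/-- `∫ ‖(g_R)''‖ e^{|t|/2} ≤ ∫ (M₂ ‖g‖ + 2 M₁ ‖g'‖ + ‖g''‖) e^{|t|/2}` for `R ≥ 1`. -/
theorem stub_cutoffMellin_l1_deriv_deriv_le (χ : ContDiffBump (0 : ℝ)) {g : ℝ → ℂ}
    (hg : ContDiff ℝ ∞ g) (h0 : Integrable (fun t : ℝ => ‖g t‖ * Real.exp (|t| / 2)))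
    (h1 : Integrable (fun t : ℝ => ‖deriv g t‖ * Real.exp (|t| / 2)))
    (h2 : Integrable (fun t : ℝ => ‖deriv (deriv g) t‖ * Real.exp (|t| / 2)))
    {M₁ M₂ : ℝ} (hM₁ : ∀ x, ‖deriv χ x‖ ≤ M₁) (hM₂ : ∀ x, ‖deriv (deriv χ) x‖ ≤ M₂)
    {R : ℝ} (hR : 1 ≤ R) :
    ∫ t : ℝ, ‖deriv (deriv (fun t : ℝ => (χ (t / R) : ℂ) * g t)) t‖ * Real.exp (|t| / 2) ≤
      ∫ t : ℝ, (M₂ * ‖g t‖ + 2 * M₁ * ‖deriv g t‖ + ‖deriv (deriv g) t‖) *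
        Real.exp (|t| / 2) := by
  refine integral_mono_of_nonneg
    (Eventually.of_forall fun t => mul_nonneg (norm_nonneg _) (Real.exp_pos _).le) ?_
    (Eventually.of_forall fun t => mul_le_mul_of_nonneg_right
      (stub_cutoffMellin_norm_deriv_deriv_le χ hg hM₁ hM₂ hR t) (Real.exp_pos _).le)
  refine (((h0.const_mul M₂).add (h1.const_mul (2 * M₁))).add h2).congr
    (Eventually.of_forall fun t => ?_)
  simp only [Pi.add_apply]
  ring

/-- `e^{(1/2)|t|} = e^{|t|/2}` (the weight of `weilL1W (1/2)` versus the hypotheses). -/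
theorem stub_cutoffMellin_exp_half (t : ℝ) : Real.exp (1 / 2 * |t|) = Real.exp (|t| / 2) := by
  congr 1
  ring

/-- **(ii)** Uniform strip decay of the cut-offs: `‖ĝ_R(s)‖ ≤ D/(1 + (Im s)²)` for `R ≥ 1`,
`|Re s - 1/2| ≤ 1/2`, with `D = ∫ ‖g‖ e + ∫ (M₂ ‖g‖ + 2 M₁ ‖g'‖ + ‖g''‖) e`, `e = e^{|t|/2}`. -/
theorem stub_cutoffMellin_uniform (χ : ContDiffBump (0 : ℝ)) {g : ℝ → ℂ} (hg : ContDiff ℝ ∞ g)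
    (h0 : Integrable (fun t : ℝ => ‖g t‖ * Real.exp (|t| / 2)))
    (h1 : Integrable (fun t : ℝ => ‖deriv g t‖ * Real.exp (|t| / 2)))
    (h2 : Integrable (fun t : ℝ => ‖deriv (deriv g) t‖ * Real.exp (|t| / 2))) :
    ∃ D : ℝ, ∀ R : ℝ, 1 ≤ R → ∀ s : ℂ, |s.re - 1 / 2| ≤ 1 / 2 →
      ‖weilMellin (fun t : ℝ => (χ (t / R) : ℂ) * g t) s‖ ≤ D / (1 + s.im ^ 2) := by
  obtain ⟨M₁, M₂, hM₁, hM₂⟩ := stub_cutoffMellin_exists_bounds χ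
  refine ⟨(∫ t : ℝ, ‖g t‖ * Real.exp (|t| / 2)) +
      ∫ t : ℝ, (M₂ * ‖g t‖ + 2 * M₁ * ‖deriv g t‖ + ‖deriv (deriv g) t‖) * Real.exp (|t| / 2),
    fun R hR s hs => ?_⟩
  have hW := stub_cutoffMellin_isWeilTest χ hg (one_pos.trans_le hR)
  refine (norm_weilMellin_le_of_abs_re_le hW hs).trans
    (div_le_div_of_nonneg_right ?_ (by positivity))
  simp only [weilDecayW, weilL1W, stub_cutoffMellin_exp_half]
  exact add_le_add (stub_cutoffMellin_l1_le χ h0 R)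
    (stub_cutoffMellin_l1_deriv_deriv_le χ hg h0 h1 h2 hM₁ hM₂ hR)

/-! ## Pointwise convergence of the transforms -/

/-- The dominator: `‖χ(t/R) g(t) e^{(s-1/2)t}‖ ≤ ‖g(t)‖ e^{|t|/2}` for `|Re s - 1/2| ≤ 1/2`. -/
theorem stub_cutoffMellin_norm_integrand_le (χ : ContDiffBump (0 : ℝ)) (g : ℝ → ℂ) {s : ℂ}
    (hs : |s.re - 1 / 2| ≤ 1 / 2) (R t : ℝ) :
    ‖(χ (t / R) : ℂ) * g t * cexp ((s - 1 / 2) * t)‖ ≤ ‖g t‖ * Real.exp (|t| / 2) := by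
  rw [norm_mul, norm_mul, Complex.norm_real, Real.norm_eq_abs, abs_of_nonneg χ.nonneg,
    Complex.norm_exp]
  have hre : ((s - 1 / 2) * (t : ℂ)).re = (s.re - 1 / 2) * t := by simp [sub_re, mul_re]
  rw [hre]
  have hexp : Real.exp ((s.re - 1 / 2) * t) ≤ Real.exp (|t| / 2) := by
    rw [Real.exp_le_exp]
    calc (s.re - 1 / 2) * t ≤ |(s.re - 1 / 2) * t| := le_abs_self _
      _ = |s.re - 1 / 2| * |t| := abs_mul _ _
      _ ≤ 1 / 2 * |t| := mul_le_mul_of_nonneg_right hs (abs_nonneg _)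
      _ = |t| / 2 := by ring
  exact mul_le_mul (mul_le_of_le_one_left (norm_nonneg _) χ.le_one) hexp (Real.exp_pos _).le
    (norm_nonneg _)

/-- **(iii)** Pointwise convergence `ĝ_R(s) → ĝ(s)` as `R → ∞` on `|Re s - 1/2| ≤ 1/2`
(dominated convergence, dominator `‖g(t)‖ e^{|t|/2}`; `χ(t/R) → χ(0) = 1` since `χ` is continuous
and `t/R → 0`). -/
theorem stub_cutoffMellin_tendsto (χ : ContDiffBump (0 : ℝ)) {g : ℝ → ℂ} (hg : ContDiff ℝ ∞ g)
    (h0 : Integrable (fun t : ℝ => ‖g t‖ * Real.exp (|t| / 2))) {s : ℂ}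
    (hs : |s.re - 1 / 2| ≤ 1 / 2) :
    Tendsto (fun R : ℝ => weilMellin (fun t : ℝ => (χ (t / R) : ℂ) * g t) s) atTop
      (𝓝 (weilMellin g s)) := by
  unfold weilMellin
  have hχc : Continuous (χ : ℝ → ℝ) := χ.continuous
  have hgc : Continuous g := hg.continuous
  refine tendsto_integral_filter_of_dominated_convergence (fun t => ‖g t‖ * Real.exp (|t| / 2))
    (Eventually.of_forall fun R => ?_)
    (Eventually.of_forall fun R => Eventually.of_forall fun t =>
      stub_cutoffMellin_norm_integrand_le χ g hs R t) h0 (Eventually.of_forall fun t => ?_)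
  · exact (by fun_prop :
      Continuous fun t : ℝ => (χ (t / R) : ℂ) * g t * cexp ((s - 1 / 2) * t)).aestronglyMeasurable
  · -- `χ(t/R) → χ(0) = 1` as `R → ∞`, hence the integrand converges to `g(t) e^{(s-1/2)t}`
    have h1 : Tendsto (fun R : ℝ => t / R) atTop (𝓝 0) := tendsto_const_nhds.div_atTop tendsto_id
    have h2 : Tendsto (fun R : ℝ => χ (t / R)) atTop (𝓝 1) := by
      have h := (hχc.tendsto 0).comp h1
      rwa [χ.one_of_mem_closedBall (Metric.mem_closedBall_self χ.rIn_pos.le)] at h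
    have h3 := (((Complex.continuous_ofReal.tendsto 1).comp h2).mul_const (g t)).mul_const
      (cexp ((s - 1 / 2) * t))
    rwa [Complex.ofReal_one, one_mul] at h3

/-! ## The registered stub -/

/-- **Stub A — the cut-off package.** For a smooth `g` with `∫ (‖g‖+‖g'‖+‖g''‖) e^{|t|/2} < ∞`
and any smooth bump `χ` (`= 1` near `0`), the cut-offs `g_R = χ(·/R)·g` are Weil test functions
(`R > 0`); their transforms obey the UNIFORM strip bound `‖ĝ_R(s)‖ ≤ D/(1+(Im s)²)` for `R ≥ 1`,
`|Re s - 1/2| ≤ 1/2` (tree `norm_weilMellin_le_of_abs_re_le` and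
`(χ_R g)'' = χ_R'' g + 2χ_R' g' + χ_R g''`, `|χ^{(j)}(t/R)|/R^j ≤ sup|χ^{(j)}|`); and
`ĝ_R(s) → ĝ(s)` pointwise there (dominated convergence, dominator `‖g(t)‖e^{|t|/2}`,
`χ(t/R) → χ(0) = 1`). -/
theorem stub_cutoffMellin :
    ∀ (χ : ContDiffBump (0 : ℝ)) (g : ℝ → ℂ), ContDiff ℝ ∞ g →
      Integrable (fun t : ℝ => ‖g t‖ * Real.exp (|t| / 2)) →
      Integrable (fun t : ℝ => ‖deriv g t‖ * Real.exp (|t| / 2)) →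
      Integrable (fun t : ℝ => ‖deriv (deriv g) t‖ * Real.exp (|t| / 2)) →
      (∀ R : ℝ, 0 < R → IsWeilTest (fun t : ℝ => (χ (t / R) : ℂ) * g t)) ∧
      (∃ D : ℝ, ∀ R : ℝ, 1 ≤ R → ∀ s : ℂ, |s.re - 1 / 2| ≤ 1 / 2 →
          ‖weilMellin (fun t : ℝ => (χ (t / R) : ℂ) * g t) s‖ ≤ D / (1 + s.im ^ 2)) ∧
      (∀ s : ℂ, |s.re - 1 / 2| ≤ 1 / 2 →
          Tendsto (fun R : ℝ => weilMellin (fun t : ℝ => (χ (t / R) : ℂ) * g t) s) atTop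
            (𝓝 (weilMellin g s))) :=
  fun χ _ hg h0 h1 h2 =>
    ⟨fun _ hR => stub_cutoffMellin_isWeilTest χ hg hR, stub_cutoffMellin_uniform χ hg h0 h1 h2,
      fun _ hs => stub_cutoffMellin_tendsto χ hg h0 hs⟩

end Summit.RiemannHypothesis.RiemannHypothesis.Theorems.RuelleBandExactFirstBand
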